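import Summits.CriticalPhenomena.PercolationContinuityZ3.Theorems.PercNearOneGluingNoHeavyLowerTailFKUpperChainGen
import Summits.CriticalPhenomena.PercolationContinuityZ3.Theorems.PercNearOneGluingNoHeavyLowerTailFKAnalogues
import Literature.Probability.Percolation.TwoSetConditionalAssociationRC
import HarnessLib

/-!
# FK sub-lane: the UPPER CHAIN under an arbitrary measure, part 2 — (GEN) ⇒ (AG-loc) ⇒ AdditiveGluing for ANY probability measure,
# and `(S5)_FK ⇒ FK.AdditiveGluingFK q` for every random-cluster measure `φ_{w,q}`, `q ≥ 1`

Support file (`--supports stmt-CriticalPhenomena-4575`), FK sub-lane `prim-bschramm-fk-2` (gen 2) of the post-continuity programme;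
builds on p205010 (kernel theorem, internal audit signed; external expert review pending).  No named facts, no sorries, no `Prop`
definitions (the kernels (S5), (GEN), (AG-loc) appear as explicit HYPOTHESES, exactly as in the `q = 1` files
`…AdditiveGluingOfAGloc.lean` / `…AdditiveGluingGenOfSurplusTransfer.lean` whose proofs are transplanted here); standard axioms.
Part 1 (`…FKUpperChainGen.lean`): `sum_measureReal_firstRank_under`, `setIntegral_clusterFun_ge_of_cpa`, `gen_firstRank_of_surplusTransfer_under`
((S5)_μ ⟹ (GEN)_μ under one-cluster conditional positive association).

THIS FILE.  For a probability measure `μ` on the bond configurations of `Fin n` (patterns `P^x_a`, means `m_a`, surplus `Sur_x(T)` as in part 1):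
* `agloc_firstRank_of_gen_under` — (GEN)_μ ⟹ (AG-loc)_μ (`μ(o ↔ A, o ↮ b) ≤ Σ_a μ(P_a)(1 − μ(a ↔ b))`), measure bookkeeping with `F = 1{b ∈ ·}`;
* `additiveGluingUnder_of_agloc_firstRank` — (AG-loc)_μ ⟹ `FK.AdditiveGluingUnder μ A o b`, for EVERY probability measure;
* `additiveGluingUnder_of_surplusTransfer` — one-cluster CPA + (S5)_μ for all relay sets ⟹ additive gluing under `μ` for all `A, o, b`;
* `additiveGluingFK_of_surplusTransferFK` — **for every `q ≥ 1`: (S5) for `φ_{w,q} = rcMeasureW w q ∅` on all finite weighted graphs ⟹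
  `FK.AdditiveGluingFK q`**, the CPA input being van den Berg–Häggström–Kahn's Theorem 2.1/1.3 for the random-cluster measure
  (`BHK2006_clusterConditionalPositiveAssociation_rc`, tree, `q ≥ 1`).

So of the chain CSH ⇒ (S5) ⇒ (GEN) ⇒ (AG-loc) ⇒ AdditiveGluing, everything above (S5) transplants to `φ_{w,q}`, `q ≥ 1`, as a tree theorem;
the open research item `FK.AdditiveGluingFKMonotone` (= `∀ q ≥ 1, AdditiveGluingFK q`) is REDUCED to the surplus-transfer inequality (S5)
for `φ_{w,q}` (census: 0 exact violations on all connected graphs with `n ≤ 6` vertices, `q ≤ 100`, three engines; bschramm/FK-Q2.md §6).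
Nothing is claimed about (S5) for `q ≠ 1`.
[cite: VandenbergHaggstromKahn2005, Thm. 1.3 (p. 6), Thm. 2.1 (p. 9)] [cite: KozmaNitzan2024, Conj. 1 (p. 3), Conj. 4 (p. 32)]
[cite: Grimmett2006, §1.4 eq. (1.20) (p. 15); Thm. (3.8)]
-/

noncomputable section

namespace Summit.CriticalPhenomena.PercolationContinuityZ3.Theorems.FK

open MeasureTheory Set
open Literature.Probability.LatticeModels
open Literature.Probability.Percolation Literature.Probability.Percolation.KNPreFKG
open Summit.CriticalPhenomena.PercolationContinuityZ3.Theorems.AGloc (exists_rank_compat)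

variable {n : ℕ}

/-! ## (GEN)_μ ⟹ (AG-loc)_μ ⟹ additive gluing under `μ` — measure bookkeeping only -/

/-- **(GEN) ⟹ (AG-loc) under any probability measure.**  If the master form (GEN) holds under `μ` for relay sets of size `≤ K` (every
monotone nonnegative set function and compatible injective rank), then the localised union bound in first-in-rank form
`μ(o ↔ A, o ↮ b) ≤ Σ_a μ(P_a)(1 − μ(a ↔ b))` holds under `μ` for relay sets of size `≤ K` (take `F = 1{b ∈ ·}`).
[cite: KozmaNitzan2024, Conj. 4 (p. 32), Thm. 10 (p. 32)] -/
theorem agloc_firstRank_of_gen_under (μ : Measure (BondConfig (Fin n))) [IsProbabilityMeasure μ] (K : ℕ)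
    (hgen : ∀ (A : Finset (Fin n)) (o : Fin n) (F : Set (Fin n) → ℝ) (r : Fin n → ℕ),
      A.card ≤ K → (∀ S T : Set (Fin n), S ⊆ T → F S ≤ F T) → (∀ S, 0 ≤ F S) → Set.InjOn r ↑A →
      (∀ a ∈ A, ∀ a' ∈ A, r a < r a' → ∫ ω, F (openCluster ω a) ∂μ ≤ ∫ ω, F (openCluster ω a') ∂μ) →
      ∑ a ∈ A, μ.real (openConn o a ∩ ⋂ a' ∈ A.filter (fun a' => r a' < r a), (openConn o a')ᶜ : Set (BondConfig (Fin n))) *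
          ∫ ω, F (openCluster ω a) ∂μ ≤
        ∫ ω in (⋃ a ∈ A, openConn o a), F (openCluster ω o) ∂μ) :
    ∀ (A : Finset (Fin n)) (o b : Fin n) (r : Fin n → ℕ), A.card ≤ K → Set.InjOn r ↑A →
      (∀ a ∈ A, ∀ a' ∈ A, r a < r a' → μ.real (openConn a b) ≤ μ.real (openConn a' b)) →
      μ.real ((⋃ a ∈ A, openConn o a) ∩ (openConn o b)ᶜ : Set (BondConfig (Fin n))) ≤
        ∑ a ∈ A, μ.real (openConn o a ∩ ⋂ a' ∈ A.filter (fun a' => r a' < r a), (openConn o a')ᶜ : Set (BondConfig (Fin n))) *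
          (1 - μ.real (openConn a b)) := by
  intro A o b r hK hr hcompat
  classical
  have hmeas : ∀ S : Set (BondConfig (Fin n)), MeasurableSet S := fun S => (Set.toFinite S).measurableSet
  -- the set function `F = 1{b ∈ ·}`
  set F : Set (Fin n) → ℝ := fun M => if b ∈ M then 1 else 0 with hF
  have hFmono : ∀ S T : Set (Fin n), S ⊆ T → F S ≤ F T := by
    intro S T hST
    simp only [hF]
    by_cases hS : b ∈ S
    · rw [if_pos hS, if_pos (hST hS)]
    · rw [if_neg hS]
      split_ifs <;> norm_num
  have hF0 : ∀ S, 0 ≤ F S := by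
    intro S
    simp only [hF]
    split_ifs <;> norm_num
  -- `F(C(x)) = 1_{x ↔ b}`
  have hFind : ∀ x : Fin n, (fun ω : BondConfig (Fin n) => F (openCluster ω x)) =
      (openConn x b : Set (BondConfig (Fin n))).indicator 1 := by
    intro x
    funext ω
    simp only [hF]
    by_cases hω : ω ∈ (openConn x b : Set (BondConfig (Fin n)))
    · rw [Set.indicator_of_mem hω, Pi.one_apply, if_pos (show b ∈ openCluster ω x from hω)]
    · rw [Set.indicator_of_notMem hω, if_neg (show b ∉ openCluster ω x from hω)]
  have hint : ∀ x : Fin n, ∫ ω, F (openCluster ω x) ∂μ = μ.real (openConn x b) := by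
    intro x
    rw [hFind x, integral_indicator_one (hmeas _)]
  have hsetint : ∫ ω in (⋃ a ∈ A, openConn o a), F (openCluster ω o) ∂μ =
      μ.real ((⋃ a ∈ A, openConn o a) ∩ openConn o b : Set (BondConfig (Fin n))) := by
    rw [hFind o, ← integral_indicator (hmeas _), Set.indicator_indicator, integral_indicator_one ((hmeas _).inter (hmeas _))]
  have hcompat' : ∀ a ∈ A, ∀ a' ∈ A, r a < r a' → ∫ ω, F (openCluster ω a) ∂μ ≤ ∫ ω, F (openCluster ω a') ∂μ := by
    intro a ha a' ha' hlt
    rw [hint a, hint a']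
    exact hcompat a ha a' ha' hlt
  have key := hgen A o F r hK hFmono hF0 hr hcompat'
  simp only [hint] at key
  rw [hsetint] at key
  have hsp : μ.real (⋃ a ∈ A, openConn o a) =
      μ.real ((⋃ a ∈ A, openConn o a) ∩ openConn o b : Set (BondConfig (Fin n))) +
        μ.real ((⋃ a ∈ A, openConn o a) ∩ (openConn o b)ᶜ : Set (BondConfig (Fin n))) := by
    rw [← measureReal_inter_add_sdiff (s := ⋃ a ∈ A, (openConn o a : Set (BondConfig (Fin n)))) (h := measure_ne_top _ _)
      (hmeas (openConn o b)), Set.sdiff_eq]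
  have hsum := sum_measureReal_firstRank_under μ A r o hr
  have hexp : ∑ a ∈ A, μ.real (openConn o a ∩ ⋂ a' ∈ A.filter (fun a' => r a' < r a), (openConn o a')ᶜ : Set (BondConfig (Fin n))) *
        (1 - μ.real (openConn a b)) =
      ∑ a ∈ A, μ.real (openConn o a ∩ ⋂ a' ∈ A.filter (fun a' => r a' < r a), (openConn o a')ᶜ : Set (BondConfig (Fin n))) -
        ∑ a ∈ A, μ.real (openConn o a ∩ ⋂ a' ∈ A.filter (fun a' => r a' < r a), (openConn o a')ᶜ : Set (BondConfig (Fin n))) *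
          μ.real (openConn a b) := by
    rw [← Finset.sum_sub_distrib]
    refine Finset.sum_congr rfl fun a _ => ?_
    ring
  rw [hexp, hsum]
  linarith [key, hsp]

/-- **(AG-loc) ⟹ additive gluing, under any probability measure**: if the localised union bound (first-in-rank form) holds under `μ`
for the relay set `A` and every reliability-compatible injective rank, then `FK.AdditiveGluingUnder μ A o b`
(`μ(o ↔ A) − t ≤ μ(o ↔ b)` whenever `t ≥ max_a μ(a ↮ b)`). [cite: KozmaNitzan2024, Conj. 1 (p. 3)] -/
theorem additiveGluingUnder_of_agloc_firstRank (μ : Measure (BondConfig (Fin n))) [IsProbabilityMeasure μ]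
    (A : Finset (Fin n)) (o b : Fin n)
    (h : ∀ r : Fin n → ℕ, Set.InjOn r ↑A →
      (∀ a ∈ A, ∀ a' ∈ A, r a < r a' → μ.real (openConn a b) ≤ μ.real (openConn a' b)) →
      μ.real ((⋃ a ∈ A, openConn o a) ∩ (openConn o b)ᶜ : Set (BondConfig (Fin n))) ≤
        ∑ a ∈ A, μ.real (openConn o a ∩ ⋂ a' ∈ A.filter (fun a' => r a' < r a), (openConn o a')ᶜ : Set (BondConfig (Fin n))) *
          (1 - μ.real (openConn a b))) :
    AdditiveGluingUnder μ A o b := by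
  intro t ht hrel
  classical
  have hmeas : ∀ S : Set (BondConfig (Fin n)), MeasurableSet S := fun S => (Set.toFinite S).measurableSet
  obtain ⟨r, hrinj, hrc⟩ := exists_rank_compat A (fun a => μ.real (openConn a b))
  have key := h r hrinj hrc
  have h1 : ∑ a ∈ A, μ.real (openConn o a ∩ ⋂ a' ∈ A.filter (fun a' => r a' < r a), (openConn o a')ᶜ : Set (BondConfig (Fin n))) *
        (1 - μ.real (openConn a b)) ≤
      ∑ a ∈ A, μ.real (openConn o a ∩ ⋂ a' ∈ A.filter (fun a' => r a' < r a), (openConn o a')ᶜ : Set (BondConfig (Fin n))) * t := by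
    refine Finset.sum_le_sum fun a ha => ?_
    exact mul_le_mul_of_nonneg_left (by linarith [hrel a ha]) measureReal_nonneg
  have h2 : ∑ a ∈ A, μ.real (openConn o a ∩ ⋂ a' ∈ A.filter (fun a' => r a' < r a), (openConn o a')ᶜ : Set (BondConfig (Fin n))) * t =
      t * μ.real (⋃ a ∈ A, openConn o a) := by
    rw [← Finset.sum_mul, mul_comm, sum_measureReal_firstRank_under μ A r o hrinj]
  have h3 : μ.real (⋃ a ∈ A, openConn o a) ≤ 1 := by
    have : μ.real (⋃ a ∈ A, openConn o a) ≤ μ.real (Set.univ : Set (BondConfig (Fin n))) :=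
      measureReal_mono (Set.subset_univ _) (measure_ne_top _ _)
    rwa [probReal_univ] at this
  have h4 : μ.real (⋃ a ∈ A, openConn o a) - μ.real (openConn o b) ≤
      μ.real ((⋃ a ∈ A, openConn o a) ∩ (openConn o b)ᶜ : Set (BondConfig (Fin n))) := by
    have hsp : μ.real (⋃ a ∈ A, openConn o a) =
        μ.real ((⋃ a ∈ A, openConn o a) ∩ openConn o b : Set (BondConfig (Fin n))) +
          μ.real ((⋃ a ∈ A, openConn o a) ∩ (openConn o b)ᶜ : Set (BondConfig (Fin n))) := by
      rw [← measureReal_inter_add_sdiff (s := ⋃ a ∈ A, (openConn o a : Set (BondConfig (Fin n)))) (h := measure_ne_top _ _)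
        (hmeas (openConn o b)), Set.sdiff_eq]
    have hm : μ.real ((⋃ a ∈ A, openConn o a) ∩ openConn o b : Set (BondConfig (Fin n))) ≤ μ.real (openConn o b) :=
      measureReal_mono Set.inter_subset_right (measure_ne_top _ _)
    linarith
  have h5 : t * μ.real (⋃ a ∈ A, openConn o a) ≤ t := by
    simpa using mul_le_mul_of_nonneg_left h3 ht
  linarith [key, h1, h2, h4, h5]

/-- **Additive gluing under `μ` from (S5) under `μ`.**  For a probability measure `μ` on the bond configurations of `Fin n` with the
one-cluster conditional positive association (vdBHK Thm 1.3 shape), the surplus-transfer inequality (S5) for all relay sets, observers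
and monotone nonnegative set functions implies additive gluing `μ(o ↔ b) ≥ μ(o ↔ A) − max_a μ(a ↮ b)` for all `A, o, b`.
[cite: VandenbergHaggstromKahn2005, Thm. 1.3 (p. 6)] [cite: KozmaNitzan2024, Conj. 1 (p. 3), Conj. 4 (p. 32)] -/
theorem additiveGluingUnder_of_surplusTransfer (μ : Measure (BondConfig (Fin n))) [IsProbabilityMeasure μ]
    (hCPA : ∀ (s : Fin n) (X : Set (Fin n)) (F G : Set (Sym2 (Fin n)) → ℝ), Monotone F → Monotone G → s ∉ X →
      (∫ ω in {ω : BondConfig (Fin n) | ∀ x ∈ X, ¬ (openGraph ω).Reachable s x}, F (openEdgeCluster ω s) ∂μ) *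
        (∫ ω in {ω : BondConfig (Fin n) | ∀ x ∈ X, ¬ (openGraph ω).Reachable s x}, G (openEdgeCluster ω s) ∂μ) ≤
      μ.real {ω : BondConfig (Fin n) | ∀ x ∈ X, ¬ (openGraph ω).Reachable s x} *
        ∫ ω in {ω : BondConfig (Fin n) | ∀ x ∈ X, ¬ (openGraph ω).Reachable s x},
          F (openEdgeCluster ω s) * G (openEdgeCluster ω s) ∂μ)
    (hS5 : ∀ (T : Finset (Fin n)) (o v : Fin n) (F : Set (Fin n) → ℝ) (r : Fin n → ℕ),
      v ∉ T → (∀ S S' : Set (Fin n), S ⊆ S' → F S ≤ F S') → (∀ S, 0 ≤ F S) → Set.InjOn r ↑T →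
      (∀ a ∈ T, ∀ a' ∈ T, r a < r a' → ∫ ω, F (openCluster ω a) ∂μ ≤ ∫ ω, F (openCluster ω a') ∂μ) →
      μ.real ({ω : BondConfig (Fin n) | ∀ a ∈ T, ¬ (openGraph ω).Reachable v a} ∩ openConn o v) *
          (∫ ω in (⋃ a ∈ T, openConn v a), F (openCluster ω v) ∂μ -
            ∑ a ∈ T, μ.real (openConn v a ∩ ⋂ a' ∈ T.filter (fun a' => r a' < r a), (openConn v a')ᶜ : Set (BondConfig (Fin n))) *
              ∫ ω, F (openCluster ω a) ∂μ) ≤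
        μ.real {ω : BondConfig (Fin n) | ∀ a ∈ T, ¬ (openGraph ω).Reachable v a} *
          (∫ ω in (⋃ a ∈ T, openConn o a), F (openCluster ω o) ∂μ -
            ∑ a ∈ T, μ.real (openConn o a ∩ ⋂ a' ∈ T.filter (fun a' => r a' < r a), (openConn o a')ᶜ : Set (BondConfig (Fin n))) *
              ∫ ω, F (openCluster ω a) ∂μ))
    (A : Finset (Fin n)) (o b : Fin n) : AdditiveGluingUnder μ A o b := by
  refine additiveGluingUnder_of_agloc_firstRank μ A o b fun r hr hc => ?_
  refine agloc_firstRank_of_gen_under μ A.card (fun A' o' F r' hA' hF hF0 hr' hc' => ?_) A o b r le_rfl hr hc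
  rcases Nat.eq_zero_or_pos A.card with h0 | hpos
  · -- `A' = ∅`
    have : A'.card = 0 := by omega
    rw [Finset.card_eq_zero.1 this]
    simp
  · obtain ⟨K, hK⟩ : ∃ K, A.card = K + 1 := ⟨A.card - 1, by omega⟩
    exact gen_firstRank_of_surplusTransfer_under μ hCPA K (fun T o v F r _ => hS5 T o v F r) A' o' F r' (hK ▸ hA') hF hF0 hr' hc'

/-! ## The random-cluster measure, `q ≥ 1` -/

/-- **FK additive gluing from FK surplus transfer, every `q ≥ 1`.**  If the surplus-transfer inequality (S5) holds for the random-cluster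
measure `φ_{w,q} = rcMeasureW w q ∅` on every finite weighted graph (all relay sets `T`, observers `o`, `v ∉ T`, monotone nonnegative set
functions `F`, `m`-compatible injective ranks), then `FK.AdditiveGluingFK q` holds.  The one-cluster conditional positive association
input is van den Berg–Häggström–Kahn's Theorem 1.3/2.1 for `φ_{𝐩,q}`, `q ≥ 1` (tree: `BHK2006_clusterConditionalPositiveAssociation_rc`);
the rest is `additiveGluingUnder_of_surplusTransfer`.  At `q = 1` the hypothesis is the tree theorem `Theorems.surplusTransfer`
(builds on p205010 (kernel theorem, internal audit signed; external expert review pending)); for `q > 1` it is the open item (S5)_FK of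
bschramm/FK-Q2.md. [cite: VandenbergHaggstromKahn2005, Thm. 2.1 (p. 9), Thm. 1.3 (p. 6)] [cite: Grimmett2006, §1.4 eq. (1.20) (p. 15); Thm. (3.8)]
[cite: KozmaNitzan2024, Conj. 1 (p. 3)] -/
theorem additiveGluingFK_of_surplusTransferFK {q : ℝ} (hq : 1 ≤ q)
    (hS5 : ∀ (n : ℕ) (w : Sym2 (Fin n) → unitInterval) (T : Finset (Fin n)) (o v : Fin n) (F : Set (Fin n) → ℝ) (r : Fin n → ℕ),
      v ∉ T → (∀ S S' : Set (Fin n), S ⊆ S' → F S ≤ F S') → (∀ S, 0 ≤ F S) → Set.InjOn r ↑T →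
      (∀ a ∈ T, ∀ a' ∈ T, r a < r a' →
        ∫ ω, F (openCluster ω a) ∂(rcMeasureW w q ∅) ≤ ∫ ω, F (openCluster ω a') ∂(rcMeasureW w q ∅)) →
      (rcMeasureW w q ∅).real ({ω : BondConfig (Fin n) | ∀ a ∈ T, ¬ (openGraph ω).Reachable v a} ∩ openConn o v) *
          (∫ ω in (⋃ a ∈ T, openConn v a), F (openCluster ω v) ∂(rcMeasureW w q ∅) -
            ∑ a ∈ T, (rcMeasureW w q ∅).real
                (openConn v a ∩ ⋂ a' ∈ T.filter (fun a' => r a' < r a), (openConn v a')ᶜ : Set (BondConfig (Fin n))) *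
              ∫ ω, F (openCluster ω a) ∂(rcMeasureW w q ∅)) ≤
        (rcMeasureW w q ∅).real {ω : BondConfig (Fin n) | ∀ a ∈ T, ¬ (openGraph ω).Reachable v a} *
          (∫ ω in (⋃ a ∈ T, openConn o a), F (openCluster ω o) ∂(rcMeasureW w q ∅) -
            ∑ a ∈ T, (rcMeasureW w q ∅).real
                (openConn o a ∩ ⋂ a' ∈ T.filter (fun a' => r a' < r a), (openConn o a')ᶜ : Set (BondConfig (Fin n))) *
              ∫ ω, F (openCluster ω a) ∂(rcMeasureW w q ∅))) :
    AdditiveGluingFK q := by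
  rw [additiveGluingFK_iff_under]
  intro n w A o b
  haveI := isProbabilityMeasure_rcMeasureW w (one_pos.trans_le hq) (∅ : Set (Fin n))
  exact additiveGluingUnder_of_surplusTransfer (rcMeasureW w q ∅)
    (fun s X F G hF hG _ => BHK2006_clusterConditionalPositiveAssociation_rc w hq s X F G hF hG)
    (fun T o' v F r hv hF hF0 hr hc => hS5 n w T o' v F r hv hF hF0 hr hc) A o b

end Summit.CriticalPhenomena.PercolationContinuityZ3.Theorems.FK

end
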